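import Literature.Probability.LatticeModels.IsingDecoration
import HarnessLib

/-!
# Sharpness of the Bethe threshold: the star graph
# (crux `SubharmonicOffOrigin`, stmt-CriticalPhenomena-1341, route PerfectScreening; by-product)

Companion of `PerfectScreeningSubharmonicOffOriginBetheThreshold.lean` (`Bethe.finiteVolume_bethe`:
on ANY graph, `(deg x − 1)·tanh β ≤ 1` implies `deg x·⟨σ_oσ_x⟩ ≤ Σ_{y∼x}⟨σ_oσ_y⟩`, `o ≠ x`).  Here the
threshold is shown to be SHARP among graphs with a vertex of degree `n`: on the star `K_{1,n}`
(Mathlib's `completeBipartiteGraph Unit (Fin n)`, centre `inl ()`, leaves `inr i`) with the source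
at a leaf `o = inr i` and `x` the centre, the Ising model at inverse temperature `β` (whole finite
graph, zero field) has `⟨σ_oσ_x⟩ = t`, `⟨σ_oσ_{o}⟩ = 1`, `⟨σ_oσ_{y}⟩ = t²` for the other leaves
(`t = tanh β`; heat-bath identity at a leaf, Friedli–Velenik 2017 Lemma 6.7), so that
`Σ_{y∼x}⟨σ_oσ_y⟩ − n⟨σ_oσ_x⟩ = 1 + (n−1)t² − n t = (1 − t)(1 − (n−1)t) < 0` as soon as
`(n−1)·tanh β > 1` (`star_centre_violates_bethe`).  With `n = 6` this is the finite form of the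
Bethe-lattice no-go recorded on the crux card and in cdisprove's `Disproof.lean` §(c): no inequality
that is uniform over graphs of degree `6` can prove the crux `SubharmonicOffOrigin` at
`tanh β_c(3) = 0.2181 > 1/5`; a proof must use the loop structure of `ℤ³`.

Adjacency of `completeBipartiteGraph` carries no `DecidableRel` instance in Mathlib; the statements
use classical decidability (`open scoped Classical`), which only affects how the (propositionally
unique) neighbour finsets are computed.

References: S. Friedli, Y. Velenik, *Statistical Mechanics of Lattice Systems* (CUP 2017), Lemma 6.7
and Exercise 3.11 (heat-bath kernel) [FriedliVelenik2017]; R. J. Baxter, *Exactly Solved Models in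
Statistical Mechanics* (1982), Ch. 4 (Bethe lattice, `tanh β_c = 1/(q−1)`).  Helpers of
stmt-CriticalPhenomena-1341 (`--supports`); no definition, no named fact.
-/

noncomputable section

open Finset
open Literature.Probability.LatticeModels
open scoped Classical

namespace Summit.CriticalPhenomena.Ising3DConformalLimit.Theorems.PerfectScreening.Bethe

/-- `tanh(β u) = u · tanh β` for a spin `u = ±1` (oddness of `tanh`). -/
theorem tanh_mul_spin (β : ℝ) (u : ℤˣ) :
    Real.tanh (β * ((u : ℤ) : ℝ)) = ((u : ℤ) : ℝ) * Real.tanh β := by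
  rcases Int.units_eq_one_or u with rfl | rfl
  · simp
  · simp [Real.tanh_neg]

/-- A finite-volume Gibbs expectation of a constant is that constant (probability measure). -/
theorem isingExpect_const_fun {V : Type*} [DecidableEq V] (G : SimpleGraph V) [G.LocallyFinite]
    (Λ : Finset V) (β h : ℝ) (bc : BoundaryCondition V) (c : ℝ) :
    isingExpect G Λ β h bc (fun _ => c) = c := by
  simp [isingExpect]

/-- The neighbours of the centre of the star `K_{1,n}` are the `n` leaves. -/
theorem star_neighborFinset_inl (n : ℕ) :
    (completeBipartiteGraph Unit (Fin n)).neighborFinset (Sum.inl ()) =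
      (Finset.univ : Finset (Fin n)).map ⟨Sum.inr, Sum.inr_injective⟩ := by
  ext w
  rw [SimpleGraph.mem_neighborFinset, completeBipartiteGraph_adj, Finset.mem_map]
  cases w with
  | inl a => simp
  | inr b => simp

/-- The only neighbour of a leaf of the star `K_{1,n}` is the centre. -/
theorem star_neighborFinset_inr (n : ℕ) (i : Fin n) :
    (completeBipartiteGraph Unit (Fin n)).neighborFinset (Sum.inr i) = {Sum.inl ()} := by
  ext w
  rw [SimpleGraph.mem_neighborFinset, completeBipartiteGraph_adj, Finset.mem_singleton]
  cases w with
  | inl a => simp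
  | inr b => simp

/-- The centre of the star `K_{1,n}` has degree `n`. -/
theorem star_degree_inl (n : ℕ) : (completeBipartiteGraph Unit (Fin n)).degree (Sum.inl ()) = n := by
  rw [← SimpleGraph.card_neighborFinset_eq_degree, star_neighborFinset_inl, Finset.card_map,
    Finset.card_univ, Fintype.card_fin]

/-- **Heat bath at a leaf** (Friedli–Velenik 2017, Lemma 6.7): for an observable `g` not reading the
leaf `inr i`, `⟨σ_{inr i} g⟩ = tanh β · ⟨σ_{centre} g⟩` on the star (the leaf's only neighbour is the
centre and `tanh(β σ) = σ tanh β`). -/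
theorem star_leaf_heatBath (n : ℕ) (β : ℝ) (i : Fin n) {g : SpinConfig (Unit ⊕ Fin n) → ℝ}
    (hgm : Measurable g) (hg : ∀ σ u, g (Function.update σ (Sum.inr i) u) = g σ) :
    isingExpect (completeBipartiteGraph Unit (Fin n)) Finset.univ β 0 (.fixed 1)
        (fun σ => spinAt (Sum.inr i) σ * g σ) =
      Real.tanh β * isingExpect (completeBipartiteGraph Unit (Fin n)) Finset.univ β 0 (.fixed 1)
        (fun σ => spinAt (Sum.inl ()) σ * g σ) := by
  rw [isingExpect_spinAt_mul_eq_tanh (completeBipartiteGraph Unit (Fin n)) (Finset.mem_univ _) β 1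
      hgm hg, star_neighborFinset_inr,
    ← isingExpect_const_mul' (completeBipartiteGraph Unit (Fin n)) Finset.univ 0 (.fixed 1) β
      (Real.tanh β) (f := fun σ => spinAt (Sum.inl ()) σ * g σ)
      (show Measurable (fun σ => spinAt (Sum.inl ()) σ * g σ) from (measurable_spinAt _).mul hgm)]
  congr 1
  funext σ
  rw [Finset.sum_singleton, spinAt, tanh_mul_spin]
  ring

/-- On the star, `⟨σ_{leaf} σ_{centre}⟩ = tanh β`. -/
theorem star_leaf_centre (n : ℕ) (β : ℝ) (i : Fin n) :
    isingExpect (completeBipartiteGraph Unit (Fin n)) Finset.univ β 0 (.fixed 1)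
        (spinPair (Sum.inr i) (Sum.inl ())) = Real.tanh β := by
  have h := star_leaf_heatBath n β i (g := spinAt (Sum.inl ())) (measurable_spinAt _)
    (fun σ u => by simp [spinAt, Function.update_of_ne])
  have h1 : (fun σ : SpinConfig (Unit ⊕ Fin n) => spinAt (Sum.inl ()) σ * spinAt (Sum.inl ()) σ) =
      fun _ => (1 : ℝ) := funext fun σ => spinAt_mul_self _ σ
  rw [h1, isingExpect_const_fun, mul_one] at h
  exact h

/-- On the star, `⟨σ_{leaf i} σ_{leaf j}⟩ = tanh² β` for two distinct leaves. -/
theorem star_leaf_leaf (n : ℕ) (β : ℝ) {i j : Fin n} (hij : i ≠ j) :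
    isingExpect (completeBipartiteGraph Unit (Fin n)) Finset.univ β 0 (.fixed 1)
        (spinPair (Sum.inr i) (Sum.inr j)) = Real.tanh β ^ 2 := by
  have h := star_leaf_heatBath n β i (g := spinAt (Sum.inr j)) (measurable_spinAt _)
    (fun σ u => by
      have hne : (Sum.inr j : Unit ⊕ Fin n) ≠ Sum.inr i := fun h => hij (Sum.inr_injective h).symm
      simp [spinAt, Function.update_of_ne hne])
  have h2 : (fun σ : SpinConfig (Unit ⊕ Fin n) => spinAt (Sum.inl ()) σ * spinAt (Sum.inr j) σ) =
      spinPair (Sum.inr j) (Sum.inl ()) := funext fun σ => mul_comm _ _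
  rw [h2, star_leaf_centre] at h
  rw [sq]
  exact h

/-- **Sharpness of the Bethe threshold (the star `K_{1,n}` violates the inequality at its centre).**
For the Ising model on the star `K_{1,n}` (whole graph, zero field, any `β`) with the source at the
leaf `inr i`: if `(n − 1)·tanh β > 1` then
`Σ_{y ∼ centre} ⟨σ_{inr i}σ_y⟩ = 1 + (n−1)tanh²β < n·tanh β = deg(centre)·⟨σ_{inr i}σ_{centre}⟩`,
i.e. the conclusion of `Bethe.finiteGraph_bethe` / `finiteVolume_bethe` fails — their hypothesis
`(deg x − 1)·tanh β ≤ 1` is sharp.  (Heat-bath identity, Friedli–Velenik 2017 Lemma 6.7; the Bethe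
lattice threshold `tanh β = 1/(q−1)`, Baxter 1982 Ch. 4.) -/
theorem star_centre_violates_bethe : ∀ {n : ℕ} {β : ℝ}, 1 < ((n : ℝ) - 1) * Real.tanh β → ∀ i : Fin n, ∑ y ∈ (completeBipartiteGraph Unit (Fin n)).neighborFinset (Sum.inl ()), isingExpect (completeBipartiteGraph Unit (Fin n)) Finset.univ β 0 .free (spinPair (Sum.inr i) y) < ((completeBipartiteGraph Unit (Fin n)).degree (Sum.inl ()) : ℝ) * isingExpect (completeBipartiteGraph Unit (Fin n)) Finset.univ β 0 .free (spinPair (Sum.inr i) (Sum.inl ())) := by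
  intro n β ht i
  rw [← isingExpect_univ_fixed (completeBipartiteGraph Unit (Fin n)) β 0 (1 : SpinConfig (Unit ⊕ Fin n)),
    star_degree_inl, star_neighborFinset_inl, Finset.sum_map, star_leaf_centre]
  have hsum : ∑ j : Fin n, isingExpect (completeBipartiteGraph Unit (Fin n)) Finset.univ β 0 .free
      (spinPair (Sum.inr i) ((⟨Sum.inr, Sum.inr_injective⟩ : Fin n ↪ Unit ⊕ Fin n) j)) =
      1 + ((n : ℝ) - 1) * Real.tanh β ^ 2 := by
    rw [← Finset.add_sum_erase _ _ (Finset.mem_univ i)]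
    have hii : isingExpect (completeBipartiteGraph Unit (Fin n)) Finset.univ β 0 .free
        (spinPair (Sum.inr i) ((⟨Sum.inr, Sum.inr_injective⟩ : Fin n ↪ Unit ⊕ Fin n) i)) = 1 := by
      change isingExpect _ _ β 0 .free (spinPair (Sum.inr i) (Sum.inr i)) = 1
      rw [spinPair_self, isingExpect_const_fun]
    have hij : ∀ j ∈ Finset.univ.erase i, isingExpect (completeBipartiteGraph Unit (Fin n)) Finset.univ β 0 .free
        (spinPair (Sum.inr i) ((⟨Sum.inr, Sum.inr_injective⟩ : Fin n ↪ Unit ⊕ Fin n) j)) = Real.tanh β ^ 2 := by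
      intro j hj
      change isingExpect _ _ β 0 .free (spinPair (Sum.inr i) (Sum.inr j)) = _
      rw [← isingExpect_univ_fixed (completeBipartiteGraph Unit (Fin n)) β 0 (1 : SpinConfig (Unit ⊕ Fin n)),
        star_leaf_leaf n β (Finset.ne_of_mem_erase hj).symm]
    rw [hii, Finset.sum_congr rfl hij, Finset.sum_const, Finset.card_erase_of_mem (Finset.mem_univ i),
      Finset.card_univ, Fintype.card_fin, nsmul_eq_mul, Nat.cast_sub i.pos, Nat.cast_one]
  rw [hsum]
  have ht1 : Real.tanh β < 1 := Real.tanh_lt_one β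
  nlinarith [ht, ht1]

end Summit.CriticalPhenomena.Ising3DConformalLimit.Theorems.PerfectScreening.Bethe

end
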